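import Mathlib
import Literature.NumberTheory.GaloisRepresentations.GaloisRep

/-!
# Support for `TwistNormalization` (route `QuadraticWindow`, stmt-Langlands-10904), II:
# the Kummer character of `√a` — a quadratic character of `Γ_F` with prescribed signs at the
# complex conjugations, unramified away from `a` when `a ≡ 1 (mod 4)`

For a number field `F` and `0 ≠ a ∈ 𝓞 F` let `s ∈ F̄` be a square root of `a`.  The map
`g ↦ (g s)/s ∈ {±1}` is a character `θ_a : Γ_F → ℂˣ` with open kernel (`exists_kummerCharacter`):

* `θ_a(c) = sgn φ(a)` for every complex conjugation `c` attached to a real embedding `φ : F → ℝ`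
  (under `j : F̄ → ℂ` over `φ` exhibiting `c`, `j(s)² = φ(a)` is real, so `j(s)` is real when
  `φ(a) > 0` and purely imaginary when `φ(a) < 0`);
* if `4 ∣ a - 1` then every inertia group above a finite place `w ∌ a` acts trivially
  (`u = (1 + s)/2` is an algebraic integer, a root of `X² - X - (a-1)/4`; for `σ` in the inertia
  group `σ u - u ∈ 𝔓`, and `σ s = -s` would give `s ∈ 𝔓`, `a = s² ∈ 𝔓 ∩ 𝓞 F = w`).

This is the explicit (Kummer) form of the quadratic Artin character of `F(√a)/F`, including the
places above `2`.  Neukirch, *Algebraic Number Theory*, Ch. I (8.x) / Ch. V §3 (Kummer theory);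
Serre, *Abelian ℓ-adic representations*, Ch. I §2.2 (complex conjugations).
-/

set_option linter.dupNamespace false -- project-wide option (lakefile weak.linter.dupNamespace); `Summit.Langlands.Langlands` is the mandated namespace

open Literature.NumberTheory.GaloisRepresentations
open Field IsDedekindDomain NumberField Polynomial

namespace Summit.Langlands.Langlands.Theorems.TwistNormalization

/-! ## Two facts about complex numbers with real square -/

/-- A complex number with positive real square is real. [folklore] -/
theorem Complex.conj_eq_self_of_sq_pos {z : ℂ} {r : ℝ} (hz : z * z = r) (hr : 0 < r) :
    starRingEnd ℂ z = z := by
  rw [Complex.conj_eq_iff_im]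
  have hre : z.re * z.re - z.im * z.im = r := by
    have := congrArg Complex.re hz; simpa [Complex.mul_re] using this
  have him : 2 * (z.re * z.im) = 0 := by
    have := congrArg Complex.im hz; simp [Complex.mul_im] at this; linarith
  rcases mul_eq_zero.mp him with h | h
  · norm_num at h
  · rcases mul_eq_zero.mp h with h | h
    · exfalso; rw [h] at hre; nlinarith [mul_self_nonneg z.im]
    · exact h

/-- A complex number with negative real square is purely imaginary. [folklore] -/
theorem Complex.conj_eq_neg_of_sq_neg {z : ℂ} {r : ℝ} (hz : z * z = r) (hr : r < 0) :
    starRingEnd ℂ z = -z := by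
  have hre : z.re * z.re - z.im * z.im = r := by
    have := congrArg Complex.re hz; simpa [Complex.mul_re] using this
  have him : 2 * (z.re * z.im) = 0 := by
    have := congrArg Complex.im hz; simp [Complex.mul_im] at this; linarith
  have hre0 : z.re = 0 := by
    rcases mul_eq_zero.mp him with h | h
    · norm_num at h
    · rcases mul_eq_zero.mp h with h | h
      · exact h
      · exfalso; rw [h] at hre; nlinarith [mul_self_nonneg z.re]
  apply Complex.ext
  · simp [hre0]
  · simp

/-! ## The Kummer character -/

section Kummer

variable {F : Type} [Field F] [NumberField F]

omit [NumberField F] in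
/-- `g • s = s` or `g • s = -s` for a square root `s` of an element of `F`. [folklore] -/
theorem smul_sqrt_eq_or (s : AlgebraicClosure F) {a : F} (hs : s * s = algebraMap F _ a)
    (g : absoluteGaloisGroup F) : g • s = s ∨ g • s = -s := by
  have h1 : (g • s) * (g • s) = s * s := by
    rw [← smul_mul', hs, absoluteGaloisGroup.smul_def, AlgEquiv.commutes]
  have h2 : (g • s - s) * (g • s + s) = 0 := by linear_combination h1
  rcases mul_eq_zero.mp h2 with h | h
  · exact Or.inl (sub_eq_zero.mp h)
  · exact Or.inr (eq_neg_of_add_eq_zero_left h)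

/-- **The Kummer character of `√a`.**  For `0 ≠ a ∈ 𝓞 F` there is a character
`θ : Γ_F → ℂˣ` with open kernel and `θ² = 1` such that (i) `θ(c) = sgn φ(a)` for every complex
conjugation `c` at every real embedding `φ`, and (ii) if `4 ∣ a - 1`, every inertia group above a
finite place `w` with `a ∉ w` lies in `ker θ`.  (Kummer theory for the quadratic extension
`F(√a)/F`; Neukirch, *Algebraic Number Theory*, Ch. V §3; Serre 1968, Ch. I §2.2.) [folklore] -/
theorem exists_kummerCharacter (a : 𝓞 F) (ha : a ≠ 0) :
    ∃ θ : absoluteGaloisGroup F →* ℂˣ, IsOpen (θ.ker : Set (absoluteGaloisGroup F)) ∧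
      (∀ g, θ g * θ g = 1) ∧
      (∀ (φ : F →+* ℝ) (c : absoluteGaloisGroup F), IsComplexConjugation φ c →
        ((θ c : ℂˣ) : ℂ) = (SignType.sign (φ (a : F)) : ℂ)) ∧
      ((4 : 𝓞 F) ∣ a - 1 → ∀ w : HeightOneSpectrum (𝓞 F), a ∉ w.asIdeal →
        ∀ 𝔓 ∈ w.primesAbove, ∀ σ ∈ 𝔓.inertia (absoluteGaloisGroup F), θ σ = 1) := by
  classical
  -- a square root `s` of `a` in `F̄`
  obtain ⟨s, hs⟩ := IsAlgClosed.exists_pow_nat_eq (algebraMap F (AlgebraicClosure F) (a : F)) two_pos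
  rw [pow_two] at hs
  have ha' : (algebraMap F (AlgebraicClosure F) (a : F)) ≠ 0 := by
    rw [map_ne_zero_iff _ (algebraMap F (AlgebraicClosure F)).injective]
    exact_mod_cast ha
  have hs0 : s ≠ 0 := fun h => ha' (by rw [← hs, h, mul_zero])
  have hsns : -s ≠ s := fun h => hs0 (by
    have : (2 : AlgebraicClosure F) * s = 0 := by linear_combination -h
    exact (mul_eq_zero.mp this).resolve_left two_ne_zero)
  have hor := smul_sqrt_eq_or s hs
  -- the character
  let θf : absoluteGaloisGroup F → ℂˣ := fun g => if g • s = s then 1 else -1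
  have hθ1 : ∀ g, g • s = s → θf g = 1 := fun g hg => if_pos hg
  have hθ2 : ∀ g, g • s = -s → θf g = -1 := fun g hg => if_neg (by rw [hg]; exact hsns)
  have hmul : ∀ g h, θf (g * h) = θf g * θf h := by
    intro g h
    rcases hor g with hg | hg <;> rcases hor h with hh | hh
    · rw [hθ1 g hg, hθ1 h hh, hθ1 _ (by rw [mul_smul, hh, hg]), one_mul]
    · rw [hθ1 g hg, hθ2 h hh, hθ2 _ (by rw [mul_smul, hh, smul_neg, hg]), one_mul]
    · rw [hθ2 g hg, hθ1 h hh, hθ2 _ (by rw [mul_smul, hh, hg]), mul_one]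
    · rw [hθ2 g hg, hθ2 h hh, hθ1 _ (by rw [mul_smul, hh, smul_neg, hg, neg_neg])]; norm_num
  let θ : absoluteGaloisGroup F →* ℂˣ :=
    { toFun := θf, map_one' := hθ1 1 (one_smul _ _), map_mul' := hmul }
  have hθ : ∀ g, θ g = θf g := fun _ => rfl
  have hker : ∀ g, θ g = 1 ↔ g • s = s := by
    intro g
    rcases hor g with hg | hg
    · exact ⟨fun _ => hg, fun _ => hθ1 g hg⟩
    · rw [hθ, hθ2 g hg]
      exact ⟨fun h => absurd h (by norm_num [Units.ext_iff]), fun h => absurd (hg.symm.trans h) hsns⟩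
  refine ⟨θ, ?_, fun g => ?_, fun φ c hc => ?_, fun h4 w haw 𝔓 h𝔓 σ hσ => ?_⟩
  · -- open kernel: it contains `Gal(F̄/F(s))`
    apply Subgroup.isOpen_of_mem_nhds (g := 1)
    refine (krullTopology_mem_nhds_one_iff F (AlgebraicClosure F) _).mpr
      ⟨IntermediateField.adjoin F {s}, IntermediateField.adjoin.finiteDimensional
        (Algebra.IsIntegral.isIntegral s), fun g hg => ?_⟩
    rw [SetLike.mem_coe, IntermediateField.mem_fixingSubgroup_iff] at hg
    change θ g = 1
    rw [hker]
    exact hg s (IntermediateField.mem_adjoin_simple_self F s)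
  · rcases hor g with hg | hg
    · rw [hθ, hθ1 g hg, one_mul]
    · rw [hθ, hθ2 g hg]; norm_num
  · -- complex conjugations
    rw [isComplexConjugation_iff] at hc
    obtain ⟨j, hj1, hj2⟩ := hc
    have hja : j s * j s = (φ (a : F) : ℂ) := by
      rw [← map_mul, hs]
      exact congrArg (fun f : F →+* ℂ => f (a : F)) hj1
    have hφa : φ (a : F) ≠ 0 := by
      rw [map_ne_zero_iff _ φ.injective]; exact_mod_cast ha
    rcases lt_or_gt_of_ne hφa with hneg | hpos
    · -- `φ a < 0`: `j s` purely imaginary, `c • s = -s`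
      have h1 : j (c • s) = j (-s) := by
        rw [hj2, map_neg]; exact Complex.conj_eq_neg_of_sq_neg hja hneg
      rw [hθ, hθ2 c (j.injective h1), sign_neg hneg]; norm_num
    · -- `φ a > 0`: `j s` real, `c • s = s`
      have h1 : j (c • s) = j s := by rw [hj2]; exact Complex.conj_eq_self_of_sq_pos hja hpos
      rw [hθ, hθ1 c (j.injective h1), sign_pos hpos]; norm_num
  · -- inertia above `w ∌ a` acts trivially when `4 ∣ a - 1`
    haveI : 𝔓.IsPrime := h𝔓.1
    obtain ⟨b, hb⟩ := h4
    rw [hker]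
    rcases hor σ with hσs | hσs
    · exact hσs
    exfalso
    -- `s` and `u = (1+s)/2` are algebraic integers
    have hsi : IsIntegral (𝓞 F) s := by
      have hdeg : degree (C a) < degree ((X : (𝓞 F)[X]) ^ 2) := by
        rw [degree_C ha, degree_X_pow]; norm_num
      refine ⟨X ^ 2 - C a, (monic_X_pow 2).sub_of_left hdeg, ?_⟩
      simp only [eval₂_sub, eval₂_X_pow, eval₂_C]
      rw [pow_two, hs, show algebraMap (𝓞 F) (AlgebraicClosure F) a = algebraMap F _ (a : F) from rfl,
        sub_self]
    -- `h = 1/2 ∈ F ⊆ F̄`, fixed by `Γ_F`; `u = (1 + s) h`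
    set h : AlgebraicClosure F := algebraMap F (AlgebraicClosure F) (2⁻¹ : F) with hh
    have h2h : 2 * h = 1 := by
      rw [hh, ← map_ofNat (algebraMap F (AlgebraicClosure F)) 2, ← map_mul,
        mul_inv_cancel₀ (two_ne_zero' F), map_one]
    have hgh : ∀ g : absoluteGaloisGroup F, g • h = h := fun g => by
      rw [hh, absoluteGaloisGroup.smul_def, AlgEquiv.commutes]
    set u : AlgebraicClosure F := (1 + s) * h with hu
    set A : AlgebraicClosure F := algebraMap F (AlgebraicClosure F) (a : F) with hA
    have hab : A = 1 + 4 * algebraMap (𝓞 F) (AlgebraicClosure F) b := by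
      have hb' : a = 1 + 4 * b := by linear_combination hb
      have := congrArg (algebraMap (𝓞 F) (AlgebraicClosure F)) hb'
      rw [map_add, map_one, map_mul, map_ofNat] at this
      exact this
    have hui : IsIntegral (𝓞 F) u := by
      refine ⟨X ^ 2 - X - C b, ?_, ?_⟩
      · have : (X ^ 2 - X - C b : (𝓞 F)[X]) = X ^ 2 - (X + C b) := by ring
        rw [this]
        exact (monic_X_pow 2).sub_of_left (by
          refine (degree_add_le _ _).trans_lt ?_
          rw [degree_X, degree_X_pow]
          exact max_lt (by norm_num) ((degree_C_le).trans_lt (by norm_num)))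
      · simp only [eval₂_sub, eval₂_X_pow, eval₂_X, eval₂_C]
        rw [hu]
        linear_combination (1 / 4 : AlgebraicClosure F) * hs + (1 / 4 : AlgebraicClosure F) * hab +
          ((1 / 4 : AlgebraicClosure F) * ((1 + s) ^ 2 * (2 * h + 1) - 2 * (1 + s))) * h2h
    set U : absIntegers (𝓞 F) F := ⟨u, hui⟩
    set S : absIntegers (𝓞 F) F := ⟨s, hsi⟩
    -- `σ u - u = -s ∈ 𝔓`, hence `s ∈ 𝔓` and `a = s² ∈ 𝔓 ∩ 𝓞 F = w`
    have hσU : σ • U - U ∈ 𝔓 := hσ U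
    have hσu : σ • u = u - s := by
      rw [hu, smul_mul', smul_add, smul_one, hσs, hgh]
      linear_combination (-s) * h2h
    have hSU : σ • U - U = -S := Subtype.ext (by
      change σ • u - u = -s
      rw [hσu]; ring)
    have hS : S ∈ 𝔓 := by
      have := 𝔓.neg_mem hσU
      rwa [hSU, neg_neg] at this
    have hSS : S * S = algebraMap (𝓞 F) (absIntegers (𝓞 F) F) a :=
      Subtype.ext (by change s * s = algebraMap (𝓞 F) (AlgebraicClosure F) a; rw [hs, hA]; rfl)
    have hamem : a ∈ w.asIdeal := by
      rw [h𝔓.2.over, Ideal.mem_under, ← hSS]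
      exact 𝔓.mul_mem_left _ hS
    exact haw hamem

end Kummer

end Summit.Langlands.Langlands.Theorems.TwistNormalization
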